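import Mathlib
import HarnessLib
import Literature.Analysis.Calculus.CenterLipschitzLocalNewton
import Literature.Analysis.Calculus.KantorovichMajorantPrinciple
import Literature.Analysis.Calculus.MajorantNewtonSequence

/-!
# Semilocal convergence of Newton's method under Kantorovich-type conditions on the first derivative (Ezquerro–Hernández 2017, §4.1.1: Lemma 4.3, Theorems 4.4–4.5)

Topic `Literature/Analysis/Calculus`.  J. A. Ezquerro Fernández and M. Á. Hernández Verón, *Newton's
Method: an Updated Approach of Kantorovich's Theory*, Birkhäuser (2017)
[EzquerrofernandezHernandezveron2017], Chapter 4 ("Convergence conditions on the first derivative of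
the operator"), §4.1.1, replace condition (b) `‖F''(x)‖ ≤ f''(t)` of their Theorem 1.27 by conditions
on `F'` alone: for `f ∈ 𝒞²([t₀, ∞))` with `f'' ≥ 0`,

* (N1) `Γ₀ = F'(x₀)⁻¹` exists with `‖Γ₀‖ ≤ −1/f'(t₀)` and `‖Γ₀F(x₀)‖ ≤ −f(t₀)/f'(t₀)`;
* (N2) `‖F'(x) − F'(y)‖ ≤ f'(u) − f'(v)` for `‖x − y‖ ≤ u − v`, `x, y ∈ Ω`, `u, v ∈ [t₀, ∞)`,

and the scalar Newton sequence (4.1) `t_{n+1} = tₙ − f(tₙ)/f'(tₙ)`.  With `t*` the smallest zero of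
`f` in `[t₀, ∞)` they prove:

**Lemma 4.3.** `Γₙ = F'(xₙ)⁻¹` exists with `‖Γₙ‖ ≤ −1/f'(tₙ)`, `‖F(xₙ)‖ ≤ f(tₙ)` and
`‖x_{n+1} − xₙ‖ ≤ t_{n+1} − tₙ` (`n ≥ 1`).

**Theorem 4.4 (General semilocal convergence).**  If `B(x₀, t* − t₀) ⊂ Ω`, Newton's sequence
converges to a solution `x*` of `F(x) = 0`; `xₙ, x* ∈ B̄(x₀, t* − t₀)` and `‖x* − xₙ‖ ≤ t* − tₙ`
for all `n`.

**Theorem 4.5.**  If `f` has two zeros `t₀ < t* ≤ t**`, the solution is unique in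
`B(x₀, t** − t₀) ∩ Ω` if `t* < t**` and in `B̄(x₀, t* − t₀)` if `t* = t**`.

Held copy: `lit read book:ezquerro-fernandez2017-newtons-method-updated-approach-kantorovichs-theory`,
§4.1.1 (conditions (N1)–(N2), (4.1), Theorems 4.1–4.2, Lemma 4.3, Theorems 4.4–4.5 with proofs,
pp. 128–132).

## Rendering (what is typed)

* `X` Banach, `Y` normed; `F : X → Y`, `F' : X → X →L[ℝ] Y` with `HasFDerivAt F (F' x) x` on the closed
  ball `closedBall x₀ (t* − t₀)` (the book's `B(x₀, t* − t₀) ⊂ Ω`; for the open-ball uniqueness on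
  `ball x₀ (t** − t₀)`); `f f' : ℝ → ℝ` with `HasDerivAt f (f' s) s` on `Icc t₀ t*` and the convexity
  hypothesis as `MonotoneOn f' (Icc t₀ t*)` (the book's `f'' ≥ 0`; no second derivative is needed);
  "`t*` the smallest zero" as `f t* = 0 ∧ ∀ s ∈ [t₀, t*), 0 < f s`; (N1) with the operator norm of
  `(F' x₀).inverse` and `ContinuousLinearMap.IsInvertible`.
* (N2) is typed in the CENTRED form that the proofs use (the pairs `(xₙ, x_{n+1})`, the segments
  `xₙ + τ(y − xₙ)` and `(x₀, x)` all occur at points whose distance to `x₀` is controlled by the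
  level): `‖F'(b) − F'(a)‖ ≤ f'(β) − f'(α)` whenever `t₀ ≤ α ≤ β ≤ t*`, `‖a − x₀‖ ≤ α − t₀`,
  `‖b − a‖ ≤ β − α`.  This is implied by (N2) (take `u = β`, `v = α`), so every statement below is
  at least as strong as the printed one; it is also exactly the derivative comparison that Theorem 1.27
  derives from (b), so that theorem is the special case `hN := majorantNewton_fderiv_sub_le` of this file.
* The scalar side (Theorems 4.1–4.2: `(4.1)` is nondecreasing and converges to `t*`) is
  `MajorantNewtonSequence.lean`; the Banach lemma is `centerLipschitzLocal_perturbation`, taken about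
  `F'(x₀)` (`‖Γ₀‖‖F'(x) − F'(x₀)‖ ≤ 1 − f'(t)/f'(t₀) < 1`); the book's integrals
  `∫₀¹ (F'(x + τ(y − x)) − F'(x))(y − x)dτ` are replaced by the fencing theorem
  `image_norm_le_of_norm_deriv_right_le_deriv_boundary'` along the segment with the moving majorant
  `f(α + τ(β − α)) − f(α) − τf'(α)(β − α)`.
* Newton sequences are hypotheses `x (n+1) = x n − (F' (x n)).inverse (F (x n))`,
  `t (n+1) = t n − f (t n) / f' (t n)`.
* Theorem 4.5, open ball.  The printed hypothesis "two zeros `t* < t**`" is typed as `t* < t**` together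
  with `f < 0` on `(t*, t**)` (i.e. `t**` is at most the next zero), which is what the strict inequality
  `‖I − J‖ < 1` of the printed proof needs: for a convex `f` vanishing identically on `[t*, t**]` the
  scalar equation `F = f` on `X = ℝ` satisfies all the other hypotheses and has every point of
  `[t*, t**] ⊂ B(t₀, t** − t₀)` as a solution.  The proof below avoids the integral `J`: along the
  segment from the limit `x*` to a second zero `y*` with `t* − t₀ < ‖y* − x₀‖ = s₁ − t₀ < t** − t₀`, the
  map `z ↦ z − Γ₀F(z)` is fenced by `‖Γ₀‖‖y* − x*‖((f(σ) − f(t*))/(s₁ − t*) − τf'(t₀))`,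
  `σ = t* + τ(s₁ − t*)`, whose value at `τ = 1` is `< ‖y* − x*‖` because `f(s₁) < 0`.

## Contents (everything below is proved; no definitions, no named facts)

the first-order remainder estimate under (N2); the inverse bound `‖F'(x)⁻¹‖ ≤ −1/f'(t)` (Lemma 4.3
(iₙ)); the induction `‖xₙ − x₀‖ ≤ tₙ − t₀`, `‖x_{n+1} − xₙ‖ ≤ t_{n+1} − tₙ` with the Newton identity;
the residual bound `‖F(x_{n+1})‖ ≤ f(t_{n+1})` (Lemma 4.3 (iiₙ)–(iiiₙ)); ball membership;
`‖x_m − xₙ‖ ≤ t_m − tₙ`; Theorem 4.4; Theorem 4.5 in the closed ball (`‖y* − xₙ‖ ≤ t* − tₙ` for every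
solution `y* ∈ B̄(x₀, t* − t₀)`, `xₙ → y*`, uniqueness, `∃!`) and in the open ball `B(x₀, t** − t₀)`
(every solution there is the limit of the Newton sequence, uniqueness, `∃!`).
-/

open Set Filter Metric Topology

namespace Literature.Analysis.Calculus

/-! ## The first-order remainder under (N2) and the inverse bound -/

section Tools

variable {X Y : Type*} [NormedAddCommGroup X] [NormedSpace ℝ X] [NormedAddCommGroup Y]
  [NormedSpace ℝ Y] {F : X → Y} {F' : X → X →L[ℝ] Y} {g g' : ℝ → ℝ} {x₀ : X} {t₀ t' : ℝ}

/-- **First-order remainder under the centred condition (N2)** (the estimate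
`‖F(xₙ)‖ = ‖∫₀¹ (F'(x_{n−1} + τ(xₙ − x_{n−1})) − F'(x_{n−1}))(xₙ − x_{n−1})dτ‖
 ≤ ∫₀¹ (f'(t_{n−1} + τ(tₙ − t_{n−1})) − f'(t_{n−1}))(tₙ − t_{n−1})dτ = f(tₙ)` of the proof of
Lemma 4.3, in two-point form and without integrals): if `‖F'(b) − F'(a)‖ ≤ g'(β) − g'(α)` whenever
`t₀ ≤ α ≤ β ≤ t'`, `‖a − x₀‖ ≤ α − t₀`, `‖b − a‖ ≤ β − α`, then for such `a, b, α, β`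
`‖F(b) − F(a) − F'(a)(b − a)‖ ≤ g(β) − g(α) − g'(α)(β − α)`.
[cite: EzquerrofernandezHernandezveron2017, §4.1.1 Lemma 4.3, proof of (iiₙ) (p. 130)] -/
theorem fderivMajorantNewton_remainder_le
    (hF : ∀ x ∈ closedBall x₀ (t' - t₀), HasFDerivAt F (F' x) x)
    (hg : ∀ t ∈ Icc t₀ t', HasDerivAt g (g' t) t)
    (hN : ∀ ⦃a b : X⦄ ⦃α β : ℝ⦄, t₀ ≤ α → α ≤ β → β ≤ t' → ‖a - x₀‖ ≤ α - t₀ →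
      ‖b - a‖ ≤ β - α → ‖F' b - F' a‖ ≤ g' β - g' α)
    {a b : X} {α β : ℝ} (hα : t₀ ≤ α) (hαβ : α ≤ β) (hβ : β ≤ t') (ha : ‖a - x₀‖ ≤ α - t₀)
    (hab : ‖b - a‖ ≤ β - α) :
    ‖F b - F a - F' a (b - a)‖ ≤ g β - g α - g' α * (β - α) := by
  set γ : ℝ → X := fun τ => a + τ • (b - a) with hγ
  set σ : ℝ → ℝ := fun τ => α + τ * (β - α) with hσ
  have hγ' : ∀ τ, HasDerivAt γ (b - a) τ := fun τ => by
    simpa [hγ] using ((hasDerivAt_id τ).smul_const (b - a)).const_add a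
  have hσ' : ∀ τ, HasDerivAt σ (β - α) τ := fun τ => by
    simpa [hσ] using ((hasDerivAt_id τ).mul_const (β - α)).const_add α
  have hσmem : ∀ τ ∈ Icc (0:ℝ) 1, α ≤ σ τ ∧ σ τ ≤ t' := by
    intro τ hτ
    refine ⟨?_, ?_⟩
    · have : 0 ≤ τ * (β - α) := mul_nonneg hτ.1 (sub_nonneg.2 hαβ)
      simp only [hσ]; linarith
    · have : τ * (β - α) ≤ 1 * (β - α) := mul_le_mul_of_nonneg_right hτ.2 (sub_nonneg.2 hαβ)
      simp only [hσ]; linarith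
  have hγdist : ∀ τ ∈ Icc (0:ℝ) 1, ‖γ τ - a‖ ≤ σ τ - α := by
    intro τ hτ
    have h1 : γ τ - a = τ • (b - a) := by simp only [hγ]; abel
    rw [h1, norm_smul, Real.norm_of_nonneg hτ.1]
    have : τ * ‖b - a‖ ≤ τ * (β - α) := mul_le_mul_of_nonneg_left hab hτ.1
    simp only [hσ]; linarith
  have hγmem : ∀ τ ∈ Icc (0:ℝ) 1, γ τ ∈ closedBall x₀ (t' - t₀) := by
    intro τ hτ
    refine mem_closedBall.2 ?_
    rw [dist_eq_norm]
    have h1 : γ τ - x₀ = (γ τ - a) + (a - x₀) := by abel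
    rw [h1]
    refine (norm_add_le _ _).trans ?_
    linarith [hγdist τ hτ, (hσmem τ hτ).2]
  -- `ψ(τ) = F(γ τ) − F(a) − τ F'(a)(b − a)` and `B(τ) = g(σ τ) − g(α) − τ g'(α)(β − α)`
  have hψ' : ∀ τ ∈ Icc (0:ℝ) 1, HasDerivAt (fun τ => F (γ τ) - F a - τ • F' a (b - a))
      (F' (γ τ) (b - a) - F' a (b - a)) τ := by
    intro τ hτ
    have h1 : HasDerivAt (fun τ => F (γ τ)) (F' (γ τ) (b - a)) τ :=
      (hF _ (hγmem τ hτ)).comp_hasDerivAt τ (hγ' τ)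
    have h2 : HasDerivAt (fun τ : ℝ => τ • F' a (b - a)) (F' a (b - a)) τ := by
      simpa using (hasDerivAt_id τ).smul_const (F' a (b - a))
    exact (h1.sub_const (F a)).sub h2
  have hB' : ∀ τ ∈ Icc (0:ℝ) 1, HasDerivAt (fun τ => g (σ τ) - g α - τ * (g' α * (β - α)))
      (g' (σ τ) * (β - α) - g' α * (β - α)) τ := by
    intro τ hτ
    have h1 := ((hg _ ⟨hα.trans (hσmem τ hτ).1, (hσmem τ hτ).2⟩).comp τ (hσ' τ)).sub_const (g α)
    have h2 : HasDerivAt (fun τ : ℝ => τ * (g' α * (β - α))) (g' α * (β - α)) τ := by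
      simpa using (hasDerivAt_id τ).mul_const (g' α * (β - α))
    exact h1.sub h2
  have hbound : ∀ τ ∈ Ico (0:ℝ) 1,
      ‖F' (γ τ) (b - a) - F' a (b - a)‖ ≤ g' (σ τ) * (β - α) - g' α * (β - α) := by
    intro τ hτ
    have hτ' := Ico_subset_Icc_self hτ
    have h1 : ‖F' (γ τ) - F' a‖ ≤ g' (σ τ) - g' α :=
      hN hα (hσmem τ hτ').1 (hσmem τ hτ').2 ha (hγdist τ hτ')
    calc ‖F' (γ τ) (b - a) - F' a (b - a)‖ = ‖(F' (γ τ) - F' a) (b - a)‖ := by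
            rw [sub_apply]
      _ ≤ ‖F' (γ τ) - F' a‖ * ‖b - a‖ := (F' (γ τ) - F' a).le_opNorm _
      _ ≤ (g' (σ τ) - g' α) * (β - α) :=
          mul_le_mul h1 hab (norm_nonneg _) ((norm_nonneg _).trans h1)
      _ = g' (σ τ) * (β - α) - g' α * (β - α) := by ring
  have key := image_norm_le_of_norm_deriv_right_le_deriv_boundary'
    (f := fun τ => F (γ τ) - F a - τ • F' a (b - a)) (a := 0) (b := 1)
    (f' := fun τ => F' (γ τ) (b - a) - F' a (b - a))
    (fun τ hτ => (hψ' τ hτ).continuousAt.continuousWithinAt)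
    (fun τ hτ => (hψ' τ (Ico_subset_Icc_self hτ)).hasDerivWithinAt)
    (B := fun τ => g (σ τ) - g α - τ * (g' α * (β - α)))
    (B' := fun τ => g' (σ τ) * (β - α) - g' α * (β - α))
    (by simp [hγ, hσ])
    (fun τ hτ => (hB' τ hτ).continuousAt.continuousWithinAt)
    (fun τ hτ => (hB' τ (Ico_subset_Icc_self hτ)).hasDerivWithinAt)
    hbound (right_mem_Icc.2 zero_le_one)
  simpa [hγ, hσ] using key

variable {f' : ℝ → ℝ}

/-- **Lemma 4.3 (iₙ): the inverse bound from the sign of `f'`.**  If `‖F'(x₀)⁻¹‖ ≤ −1/f'(t₀)`, `f'` is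
nondecreasing on `[t₀, t']`, (N2) holds in the centred form up to level `t'`, `s ∈ [t₀, t']`,
`f'(s) < 0` and `‖z − x₀‖ ≤ s − t₀`, then `F'(z)` is invertible with `‖F'(z)⁻¹‖ ≤ −1/f'(s)` (the
Banach lemma about `F'(x₀)`: `‖Γ₀‖‖F'(z) − F'(x₀)‖ ≤ (f'(s) − f'(t₀))/(−f'(t₀)) = 1 − f'(s)/f'(t₀) < 1`;
the book perturbs about `Γ_{j−1}` with the same resulting bound).
[cite: EzquerrofernandezHernandezveron2017, §4.1.1 Lemma 4.3 (iₙ) with proof ("‖I − Γ_{j−1}F'(x_j)‖ ≤ … = 1 − f'(t_j)/f'(t_{j−1}) < 1 … ‖Γ_j‖ ≤ −1/f'(t_j)", pp. 129–130)] -/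
theorem fderivMajorantNewton_inverse_le [CompleteSpace X]
    (hA : (F' x₀).IsInvertible) (ha1 : ‖(F' x₀).inverse‖ ≤ -1 / f' t₀)
    (hmono : MonotoneOn f' (Icc t₀ t'))
    (hN : ∀ ⦃a b : X⦄ ⦃α β : ℝ⦄, t₀ ≤ α → α ≤ β → β ≤ t' → ‖a - x₀‖ ≤ α - t₀ →
      ‖b - a‖ ≤ β - α → ‖F' b - F' a‖ ≤ f' β - f' α)
    {z : X} {s : ℝ} (hs : s ∈ Icc t₀ t') (hds : f' s < 0) (hz : ‖z - x₀‖ ≤ s - t₀) :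
    (F' z).IsInvertible ∧ ‖(F' z).inverse‖ ≤ -1 / f' s := by
  have hd0s : f' t₀ ≤ f' s := hmono ⟨le_rfl, hs.1.trans hs.2⟩ hs hs.1
  have hd0 : f' t₀ < 0 := lt_of_le_of_lt hd0s hds
  -- `‖F'(z) − F'(x₀)‖ ≤ f'(s) − f'(t₀)`
  have hdiff : ‖F' z - F' x₀‖ ≤ f' s - f' t₀ :=
    hN le_rfl hs.1 hs.2 (by rw [sub_self, norm_zero, sub_self]) hz
  have hne0 : f' t₀ ≠ 0 := hd0.ne
  have hnes : f' s ≠ 0 := hds.ne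
  set r : ℝ := -1 / f' t₀ * (f' s - f' t₀) with hr
  have hq : 0 < f' s / f' t₀ := div_pos_of_neg_of_neg hds hd0
  have hr1 : 1 - r = f' s / f' t₀ := by
    rw [hr]; field_simp; ring
  have hrlt : r < 1 := by linarith
  have hinv0 : 0 ≤ -1 / f' t₀ := div_nonneg_of_nonpos (by norm_num) hd0.le
  have hB : ‖(F' x₀).inverse.comp (F' z - F' x₀)‖ ≤ r :=
    calc ‖(F' x₀).inverse.comp (F' z - F' x₀)‖ ≤ ‖(F' x₀).inverse‖ * ‖F' z - F' x₀‖ :=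
          ContinuousLinearMap.opNorm_comp_le _ _
      _ ≤ -1 / f' t₀ * (f' s - f' t₀) :=
          mul_le_mul ha1 hdiff (norm_nonneg _) hinv0
  obtain ⟨hzinv, hzb⟩ := centerLipschitzLocal_perturbation hA hB hrlt
  refine ⟨hzinv, ContinuousLinearMap.opNorm_le_bound _
    (div_nonneg_of_nonpos (by norm_num) hds.le) fun w => ?_⟩
  calc ‖(F' z).inverse w‖ ≤ (1 - r)⁻¹ * ‖(F' x₀).inverse w‖ := hzb w
    _ ≤ (1 - r)⁻¹ * (-1 / f' t₀ * ‖w‖) := by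
        refine mul_le_mul_of_nonneg_left ?_ (inv_nonneg.2 (by rw [hr1]; exact hq.le))
        exact ((F' x₀).inverse.le_opNorm w).trans (mul_le_mul_of_nonneg_right ha1 (norm_nonneg _))
    _ = -1 / f' s * ‖w‖ := by
        rw [hr1]; field_simp

end Tools

/-! ## Lemma 4.3 and Theorem 4.4 -/

section Semilocal

variable {X Y : Type*} [NormedAddCommGroup X] [NormedSpace ℝ X] [NormedAddCommGroup Y]
  [NormedSpace ℝ Y] {F : X → Y} {F' : X → X →L[ℝ] Y} {f f' : ℝ → ℝ} {x₀ : X} {t₀ tstar : ℝ}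
  {x : ℕ → X} {t : ℕ → ℝ}

/-- The induction of the proofs of Lemma 4.3 / Theorem 4.4: `‖xₙ − x₀‖ ≤ tₙ − t₀`,
`‖x_{n+1} − xₙ‖ ≤ t_{n+1} − tₙ`, and the Newton identity `F(xₙ) + F'(xₙ)(x_{n+1} − xₙ) = 0`.
[cite: EzquerrofernandezHernandezveron2017, §4.1.1 Lemma 4.3 (iₙ)–(iiiₙ) and Theorem 4.4, proofs (pp. 129–131)] -/
private theorem fmsAux_invariant [CompleteSpace X]
    (hF : ∀ z ∈ closedBall x₀ (tstar - t₀), HasFDerivAt F (F' z) z)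
    (hf : ∀ s ∈ Icc t₀ tstar, HasDerivAt f (f' s) s) (hmono : MonotoneOn f' (Icc t₀ tstar))
    (hzero : f tstar = 0) (hpos : ∀ s ∈ Ico t₀ tstar, 0 < f s) (ht0s : t₀ ≤ tstar)
    (hA : (F' x₀).IsInvertible) (ha1 : ‖(F' x₀).inverse‖ ≤ -1 / f' t₀)
    (ha2 : ‖(F' x₀).inverse (F x₀)‖ ≤ -(f t₀ / f' t₀))
    (hN : ∀ ⦃a b : X⦄ ⦃α β : ℝ⦄, t₀ ≤ α → α ≤ β → β ≤ tstar → ‖a - x₀‖ ≤ α - t₀ →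
      ‖b - a‖ ≤ β - α → ‖F' b - F' a‖ ≤ f' β - f' α)
    (ht0 : t 0 = t₀) (ht : ∀ n, t (n + 1) = t n - f (t n) / f' (t n))
    (hx0 : x 0 = x₀) (hx : ∀ n, x (n + 1) = x n - (F' (x n)).inverse (F (x n))) (n : ℕ) :
    ‖x n - x₀‖ ≤ t n - t₀ ∧ ‖x (n + 1) - x n‖ ≤ t (n + 1) - t n ∧
      F (x n) + F' (x n) (x (n + 1) - x n) = 0 := by
  have hmem := newtonMajorant_seq_mem_Icc hf hmono hzero hpos ht0s ht0 ht
  have hsucc := newtonMajorant_seq_le_succ hf hmono hzero hpos ht0s ht0 ht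
  have hlin := newtonMajorant_seq_linearization hf hmono hzero hpos ht0s ht0 ht
  induction n with
  | zero =>
    refine ⟨by rw [hx0, ht0, sub_self, norm_zero, sub_self], ?_, ?_⟩
    · have e : x 1 - x 0 = -((F' x₀).inverse (F x₀)) := by
        rw [hx 0, hx0]; abel
      rw [e, norm_neg, ht 0, ht0]
      have : t₀ - f t₀ / f' t₀ - t₀ = -(f t₀ / f' t₀) := by ring
      rw [this]; exact ha2
    · have e : x (0 + 1) - x 0 = -((F' x₀).inverse (F x₀)) := by
        rw [hx 0, hx0]; abel
      rw [e, hx0, map_neg, ← ContinuousLinearMap.comp_apply, hA.self_comp_inverse]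
      simp
  | succ n ih =>
    obtain ⟨h1, h2, h3⟩ := ih
    -- (i) distance to the centre
    have hd : ‖x (n + 1) - x₀‖ ≤ t (n + 1) - t₀ := by
      have e : x (n + 1) - x₀ = (x (n + 1) - x n) + (x n - x₀) := by abel
      rw [e]; exact (norm_add_le _ _).trans (by linarith)
    -- (iiₙ) the residual bound `‖F(x_{n+1})‖ ≤ f(t_{n+1})`
    have hres : ‖F (x (n + 1))‖ ≤ f (t (n + 1)) := by
      have hrem := fderivMajorantNewton_remainder_le hF hf hN (hmem n).1 (hsucc n)
        (hmem (n + 1)).2 h1 h2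
      have e1 : F (x (n + 1)) - F (x n) - F' (x n) (x (n + 1) - x n) = F (x (n + 1)) := by
        have : F (x n) + F' (x n) (x (n + 1) - x n) = 0 := h3
        rw [sub_sub, this, sub_zero]
      have e2 : f (t (n + 1)) - f (t n) - f' (t n) * (t (n + 1) - t n) = f (t (n + 1)) := by
        linarith [hlin n]
      rwa [e1, e2] at hrem
    refine ⟨hd, ?_, ?_⟩
    · rcases (hmem (n + 1)).2.eq_or_lt with heq | hlt
      · -- stationary case `t_{n+1} = t*`: `F(x_{n+1}) = 0`
        have hF0 : F (x (n + 1)) = 0 := by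
          rw [heq, hzero] at hres; exact norm_le_zero_iff.1 hres
        rw [hx (n + 1), hF0, map_zero, sub_zero, sub_self, norm_zero]
        linarith [hsucc (n + 1)]
      · have hds : f' (t (n + 1)) < 0 :=
          (newtonMajorant_deriv_neg hf hmono hzero hpos ⟨(hmem (n + 1)).1, hlt⟩).2
        obtain ⟨_, hΓ⟩ := fderivMajorantNewton_inverse_le hA ha1 hmono hN (hmem (n + 1)) hds hd
        have e : x (n + 2) - x (n + 1) = -((F' (x (n + 1))).inverse (F (x (n + 1)))) := by
          rw [hx (n + 1)]; abel
        rw [e, norm_neg]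
        calc ‖(F' (x (n + 1))).inverse (F (x (n + 1)))‖
            ≤ ‖(F' (x (n + 1))).inverse‖ * ‖F (x (n + 1))‖ := ContinuousLinearMap.le_opNorm _ _
          _ ≤ -1 / f' (t (n + 1)) * f (t (n + 1)) :=
              mul_le_mul hΓ hres (norm_nonneg _) (div_nonneg_of_nonpos (by norm_num) hds.le)
          _ = t (n + 2) - t (n + 1) := by
              rw [ht (n + 1)]; field_simp; ring
    · rcases (hmem (n + 1)).2.eq_or_lt with heq | hlt
      · have hF0 : F (x (n + 1)) = 0 := by
          rw [heq, hzero] at hres; exact norm_le_zero_iff.1 hres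
        have e : x (n + 1 + 1) - x (n + 1) = 0 := by
          rw [hx (n + 1), hF0, map_zero, sub_zero, sub_self]
        rw [e, hF0, map_zero, add_zero]
      · have hds : f' (t (n + 1)) < 0 :=
          (newtonMajorant_deriv_neg hf hmono hzero hpos ⟨(hmem (n + 1)).1, hlt⟩).2
        obtain ⟨hinv, _⟩ := fderivMajorantNewton_inverse_le hA ha1 hmono hN (hmem (n + 1)) hds hd
        have e : x (n + 1 + 1) - x (n + 1) = -((F' (x (n + 1))).inverse (F (x (n + 1)))) := by
          rw [hx (n + 1)]; abel
        rw [e, map_neg, ← ContinuousLinearMap.comp_apply, hinv.self_comp_inverse]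
        simp

/-- **Lemma 4.3 (iiiₙ) / Theorem 4.4: `(4.1)` majorizes the Newton sequence** —
`‖x_{n+1} − xₙ‖ ≤ t_{n+1} − tₙ` and `‖xₙ − x₀‖ ≤ tₙ − t₀` for every `n`.
[cite: EzquerrofernandezHernandezveron2017, §4.1.1 Lemma 4.3 (iiiₙ) and Theorem 4.4, proof ("{tₙ} is a majorizing real sequence of {xₙ}", p. 131)] -/
theorem fderivMajorantNewton_majorizes [CompleteSpace X]
    (hF : ∀ z ∈ closedBall x₀ (tstar - t₀), HasFDerivAt F (F' z) z)
    (hf : ∀ s ∈ Icc t₀ tstar, HasDerivAt f (f' s) s) (hmono : MonotoneOn f' (Icc t₀ tstar))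
    (hzero : f tstar = 0) (hpos : ∀ s ∈ Ico t₀ tstar, 0 < f s) (ht0s : t₀ ≤ tstar)
    (hA : (F' x₀).IsInvertible) (ha1 : ‖(F' x₀).inverse‖ ≤ -1 / f' t₀)
    (ha2 : ‖(F' x₀).inverse (F x₀)‖ ≤ -(f t₀ / f' t₀))
    (hN : ∀ ⦃a b : X⦄ ⦃α β : ℝ⦄, t₀ ≤ α → α ≤ β → β ≤ tstar → ‖a - x₀‖ ≤ α - t₀ →
      ‖b - a‖ ≤ β - α → ‖F' b - F' a‖ ≤ f' β - f' α)
    (ht0 : t 0 = t₀) (ht : ∀ n, t (n + 1) = t n - f (t n) / f' (t n))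
    (hx0 : x 0 = x₀) (hx : ∀ n, x (n + 1) = x n - (F' (x n)).inverse (F (x n))) (n : ℕ) :
    ‖x (n + 1) - x n‖ ≤ t (n + 1) - t n ∧ ‖x n - x₀‖ ≤ t n - t₀ :=
  let h := fmsAux_invariant hF hf hmono hzero hpos ht0s hA ha1 ha2 hN ht0 ht hx0 hx n
  ⟨h.2.1, h.1⟩

/-- **Lemma 4.3 (iₙ): every `F'(xₙ)` with `tₙ < t*` is invertible and `‖F'(xₙ)⁻¹‖ ≤ −1/f'(tₙ).**
[cite: EzquerrofernandezHernandezveron2017, §4.1.1 Lemma 4.3 (iₙ) ("there exists Γₙ = [F'(xₙ)]⁻¹ and ‖Γₙ‖ ≤ −1/f'(tₙ)", p. 129)] -/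
theorem fderivMajorantNewton_iterate_inverse_le [CompleteSpace X]
    (hF : ∀ z ∈ closedBall x₀ (tstar - t₀), HasFDerivAt F (F' z) z)
    (hf : ∀ s ∈ Icc t₀ tstar, HasDerivAt f (f' s) s) (hmono : MonotoneOn f' (Icc t₀ tstar))
    (hzero : f tstar = 0) (hpos : ∀ s ∈ Ico t₀ tstar, 0 < f s) (ht0s : t₀ ≤ tstar)
    (hA : (F' x₀).IsInvertible) (ha1 : ‖(F' x₀).inverse‖ ≤ -1 / f' t₀)
    (ha2 : ‖(F' x₀).inverse (F x₀)‖ ≤ -(f t₀ / f' t₀))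
    (hN : ∀ ⦃a b : X⦄ ⦃α β : ℝ⦄, t₀ ≤ α → α ≤ β → β ≤ tstar → ‖a - x₀‖ ≤ α - t₀ →
      ‖b - a‖ ≤ β - α → ‖F' b - F' a‖ ≤ f' β - f' α)
    (ht0 : t 0 = t₀) (ht : ∀ n, t (n + 1) = t n - f (t n) / f' (t n))
    (hx0 : x 0 = x₀) (hx : ∀ n, x (n + 1) = x n - (F' (x n)).inverse (F (x n))) {n : ℕ}
    (hn : t n < tstar) :
    (F' (x n)).IsInvertible ∧ ‖(F' (x n)).inverse‖ ≤ -1 / f' (t n) := by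
  have hmem := newtonMajorant_seq_mem_Icc hf hmono hzero hpos ht0s ht0 ht n
  have hds : f' (t n) < 0 := (newtonMajorant_deriv_neg hf hmono hzero hpos ⟨hmem.1, hn⟩).2
  exact fderivMajorantNewton_inverse_le hA ha1 hmono hN hmem hds
    (fderivMajorantNewton_majorizes hF hf hmono hzero hpos ht0s hA ha1 ha2 hN ht0 ht hx0 hx n).2

/-- **The Newton identity and Lemma 4.3 (iiₙ):** `F(xₙ) + F'(xₙ)(x_{n+1} − xₙ) = 0` and
`‖F(x_{n+1})‖ ≤ f(t_{n+1})` for every `n`.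
[cite: EzquerrofernandezHernandezveron2017, §4.1.1 Lemma 4.3 (iiₙ) with proof ("‖F(x_j)‖ ≤ … = f(t_j)", p. 130)] -/
theorem fderivMajorantNewton_residual_le [CompleteSpace X]
    (hF : ∀ z ∈ closedBall x₀ (tstar - t₀), HasFDerivAt F (F' z) z)
    (hf : ∀ s ∈ Icc t₀ tstar, HasDerivAt f (f' s) s) (hmono : MonotoneOn f' (Icc t₀ tstar))
    (hzero : f tstar = 0) (hpos : ∀ s ∈ Ico t₀ tstar, 0 < f s) (ht0s : t₀ ≤ tstar)
    (hA : (F' x₀).IsInvertible) (ha1 : ‖(F' x₀).inverse‖ ≤ -1 / f' t₀)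
    (ha2 : ‖(F' x₀).inverse (F x₀)‖ ≤ -(f t₀ / f' t₀))
    (hN : ∀ ⦃a b : X⦄ ⦃α β : ℝ⦄, t₀ ≤ α → α ≤ β → β ≤ tstar → ‖a - x₀‖ ≤ α - t₀ →
      ‖b - a‖ ≤ β - α → ‖F' b - F' a‖ ≤ f' β - f' α)
    (ht0 : t 0 = t₀) (ht : ∀ n, t (n + 1) = t n - f (t n) / f' (t n))
    (hx0 : x 0 = x₀) (hx : ∀ n, x (n + 1) = x n - (F' (x n)).inverse (F (x n))) (n : ℕ) :
    F (x n) + F' (x n) (x (n + 1) - x n) = 0 ∧ ‖F (x (n + 1))‖ ≤ f (t (n + 1)) := by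
  have hmem := newtonMajorant_seq_mem_Icc hf hmono hzero hpos ht0s ht0 ht
  have hsucc := newtonMajorant_seq_le_succ hf hmono hzero hpos ht0s ht0 ht
  have hlin := newtonMajorant_seq_linearization hf hmono hzero hpos ht0s ht0 ht n
  obtain ⟨h1, h2, h3⟩ := fmsAux_invariant hF hf hmono hzero hpos ht0s hA ha1 ha2 hN ht0 ht hx0 hx n
  refine ⟨h3, ?_⟩
  have hrem := fderivMajorantNewton_remainder_le hF hf hN (hmem n).1 (hsucc n) (hmem (n + 1)).2 h1 h2
  have e1 : F (x (n + 1)) - F (x n) - F' (x n) (x (n + 1) - x n) = F (x (n + 1)) := by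
    rw [sub_sub, h3, sub_zero]
  have e2 : f (t (n + 1)) - f (t n) - f' (t n) * (t (n + 1) - t n) = f (t (n + 1)) := by
    linarith
  rwa [e1, e2] at hrem

/-- The iterates stay in the closed ball `B̄(x₀, t* − t₀)` ("`xₙ ∈ B(x₀, t* − t₀)` for all `n ≥ 0`").
[cite: EzquerrofernandezHernandezveron2017, §4.1.1 Theorem 4.4, proof ("Newton's sequence {xₙ} is well-defined and xₙ ∈ B(x₀, t* − t₀) for all n ≥ 0", p. 131)] -/
theorem fderivMajorantNewton_mem_closedBall [CompleteSpace X]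
    (hF : ∀ z ∈ closedBall x₀ (tstar - t₀), HasFDerivAt F (F' z) z)
    (hf : ∀ s ∈ Icc t₀ tstar, HasDerivAt f (f' s) s) (hmono : MonotoneOn f' (Icc t₀ tstar))
    (hzero : f tstar = 0) (hpos : ∀ s ∈ Ico t₀ tstar, 0 < f s) (ht0s : t₀ ≤ tstar)
    (hA : (F' x₀).IsInvertible) (ha1 : ‖(F' x₀).inverse‖ ≤ -1 / f' t₀)
    (ha2 : ‖(F' x₀).inverse (F x₀)‖ ≤ -(f t₀ / f' t₀))
    (hN : ∀ ⦃a b : X⦄ ⦃α β : ℝ⦄, t₀ ≤ α → α ≤ β → β ≤ tstar → ‖a - x₀‖ ≤ α - t₀ →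
      ‖b - a‖ ≤ β - α → ‖F' b - F' a‖ ≤ f' β - f' α)
    (ht0 : t 0 = t₀) (ht : ∀ n, t (n + 1) = t n - f (t n) / f' (t n))
    (hx0 : x 0 = x₀) (hx : ∀ n, x (n + 1) = x n - (F' (x n)).inverse (F (x n))) (n : ℕ) :
    x n ∈ closedBall x₀ (tstar - t₀) := by
  have hmem := newtonMajorant_seq_mem_Icc hf hmono hzero hpos ht0s ht0 ht n
  have h := (fderivMajorantNewton_majorizes hF hf hmono hzero hpos ht0s hA ha1 ha2 hN ht0 ht hx0 hx n).2
  rw [mem_closedBall, dist_eq_norm]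
  linarith [hmem.2]

/-- `‖x_m − xₙ‖ ≤ t_m − tₙ` for `n ≤ m`.
[cite: EzquerrofernandezHernandezveron2017, §4.1.1 Theorem 4.4, proof ("‖xₙ − x₀‖ ≤ Σ‖x_{j+1} − x_j‖ ≤ Σ(t_{j+1} − t_j)", p. 131); §1.1.2 Theorem 1.20 (1.15)] -/
theorem fderivMajorantNewton_dist_le [CompleteSpace X]
    (hF : ∀ z ∈ closedBall x₀ (tstar - t₀), HasFDerivAt F (F' z) z)
    (hf : ∀ s ∈ Icc t₀ tstar, HasDerivAt f (f' s) s) (hmono : MonotoneOn f' (Icc t₀ tstar))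
    (hzero : f tstar = 0) (hpos : ∀ s ∈ Ico t₀ tstar, 0 < f s) (ht0s : t₀ ≤ tstar)
    (hA : (F' x₀).IsInvertible) (ha1 : ‖(F' x₀).inverse‖ ≤ -1 / f' t₀)
    (ha2 : ‖(F' x₀).inverse (F x₀)‖ ≤ -(f t₀ / f' t₀))
    (hN : ∀ ⦃a b : X⦄ ⦃α β : ℝ⦄, t₀ ≤ α → α ≤ β → β ≤ tstar → ‖a - x₀‖ ≤ α - t₀ →
      ‖b - a‖ ≤ β - α → ‖F' b - F' a‖ ≤ f' β - f' α)
    (ht0 : t 0 = t₀) (ht : ∀ n, t (n + 1) = t n - f (t n) / f' (t n))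
    (hx0 : x 0 = x₀) (hx : ∀ n, x (n + 1) = x n - (F' (x n)).inverse (F (x n))) {n m : ℕ}
    (hnm : n ≤ m) : ‖x m - x n‖ ≤ t m - t n :=
  majorizing_dist_le
    (fun k => (fderivMajorantNewton_majorizes hF hf hmono hzero hpos ht0s hA ha1 ha2 hN ht0 ht hx0 hx
      k).1) hnm

/-- **Theorem 4.4 (General semilocal convergence under (N1)–(N2)).**  With `t*` the smallest zero of
the majorant `f`, Newton's method starting at `x₀` converges to a solution `x* ∈ B̄(x₀, t* − t₀)` of
`F(x) = 0`, the scalar sequence (4.1) converges to `t*`, and `‖x* − xₙ‖ ≤ t* − tₙ` for every `n`.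
[cite: EzquerrofernandezHernandezveron2017, §4.1.1 Theorem 4.4 (General semilocal convergence) with proof (pp. 130–131); Theorem 4.2] -/
theorem fderivMajorantNewton_semilocal [CompleteSpace X]
    (hF : ∀ z ∈ closedBall x₀ (tstar - t₀), HasFDerivAt F (F' z) z)
    (hf : ∀ s ∈ Icc t₀ tstar, HasDerivAt f (f' s) s) (hmono : MonotoneOn f' (Icc t₀ tstar))
    (hzero : f tstar = 0) (hpos : ∀ s ∈ Ico t₀ tstar, 0 < f s) (ht0s : t₀ ≤ tstar)
    (hA : (F' x₀).IsInvertible) (ha1 : ‖(F' x₀).inverse‖ ≤ -1 / f' t₀)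
    (ha2 : ‖(F' x₀).inverse (F x₀)‖ ≤ -(f t₀ / f' t₀))
    (hN : ∀ ⦃a b : X⦄ ⦃α β : ℝ⦄, t₀ ≤ α → α ≤ β → β ≤ tstar → ‖a - x₀‖ ≤ α - t₀ →
      ‖b - a‖ ≤ β - α → ‖F' b - F' a‖ ≤ f' β - f' α)
    (ht0 : t 0 = t₀) (ht : ∀ n, t (n + 1) = t n - f (t n) / f' (t n))
    (hx0 : x 0 = x₀) (hx : ∀ n, x (n + 1) = x n - (F' (x n)).inverse (F (x n))) :
    Tendsto t atTop (𝓝 tstar) ∧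
      ∃ xstar ∈ closedBall x₀ (tstar - t₀), Tendsto x atTop (𝓝 xstar) ∧ F xstar = 0 ∧
        ∀ n, ‖xstar - x n‖ ≤ tstar - t n := by
  have hT : Tendsto t atTop (𝓝 tstar) := newtonMajorant_seq_tendsto hf hmono hzero hpos ht0s ht0 ht
  have hmaj : ∀ k, ‖x (k + 1) - x k‖ ≤ t (k + 1) - t k := fun k =>
    (fderivMajorantNewton_majorizes hF hf hmono hzero hpos ht0s hA ha1 ha2 hN ht0 ht hx0 hx k).1
  obtain ⟨xstar, hX, hball, hbound⟩ := majorizing_tendsto hmaj hT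
  have hmem : xstar ∈ closedBall x₀ (tstar - t₀) := by rwa [hx0, ht0] at hball
  refine ⟨hT, xstar, hmem, hX, ?_, hbound⟩
  -- `F(x*) = 0`: `‖F(x_{n+1})‖ ≤ f(t_{n+1}) → f(t*) = 0` and `F` is continuous at `x*`
  have hres : ∀ n, ‖F (x (n + 1))‖ ≤ f (t (n + 1)) := fun n =>
    (fderivMajorantNewton_residual_le hF hf hmono hzero hpos ht0s hA ha1 ha2 hN ht0 ht hx0 hx n).2
  have hfc : ContinuousAt f tstar := (hf tstar ⟨ht0s, le_rfl⟩).continuousAt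
  have hft : Tendsto (fun n => f (t (n + 1))) atTop (𝓝 0) := by
    have h := (hfc.tendsto.comp hT).comp (tendsto_add_atTop_nat 1)
    rwa [hzero] at h
  have hFn : Tendsto (fun n => ‖F (x (n + 1))‖) atTop (𝓝 0) :=
    squeeze_zero (fun n => norm_nonneg _) hres hft
  have hFc : ContinuousAt F xstar := (hF xstar hmem).continuousAt
  have hFx : Tendsto (fun n => F (x (n + 1))) atTop (𝓝 (F xstar)) :=
    hFc.tendsto.comp (hX.comp (tendsto_add_atTop_nat 1))
  have h0 : Tendsto (fun n => F (x (n + 1))) atTop (𝓝 0) :=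
    tendsto_zero_iff_norm_tendsto_zero.2 hFn
  exact tendsto_nhds_unique hFx h0

/-! ## Theorem 4.5: the closed ball `B̄(x₀, t* − t₀)` -/

/-- **`‖y* − xₙ‖ ≤ t* − tₙ` for every solution in the closed ball** (the induction of the proof of
Theorem 4.5, case `t** = t*`, valid for any `t*`): if `F(y*) = 0` and `‖y* − x₀‖ ≤ t* − t₀` then
`‖y* − xₙ‖ ≤ t* − tₙ` for every `n` (`y* − x_{n+1} = −Γₙ(F(y*) − F(xₙ) − F'(xₙ)(y* − xₙ))`, the
remainder is at most `f(t*) − f(tₙ) − f'(tₙ)(t* − tₙ)` and `‖Γₙ‖ ≤ −1/f'(tₙ)`).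
[cite: EzquerrofernandezHernandezveron2017, §4.1.1 Theorem 4.5, proof ("‖y* − x_{n+1}‖ ≤ ((t* − t_{n+1})/(t* − tₙ))‖y* − xₙ‖ ≤ t* − t_{n+1}", p. 132)] -/
theorem fderivMajorantNewton_zero_dist_le [CompleteSpace X]
    (hF : ∀ z ∈ closedBall x₀ (tstar - t₀), HasFDerivAt F (F' z) z)
    (hf : ∀ s ∈ Icc t₀ tstar, HasDerivAt f (f' s) s) (hmono : MonotoneOn f' (Icc t₀ tstar))
    (hzero : f tstar = 0) (hpos : ∀ s ∈ Ico t₀ tstar, 0 < f s) (ht0s : t₀ ≤ tstar)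
    (hA : (F' x₀).IsInvertible) (ha1 : ‖(F' x₀).inverse‖ ≤ -1 / f' t₀)
    (ha2 : ‖(F' x₀).inverse (F x₀)‖ ≤ -(f t₀ / f' t₀))
    (hN : ∀ ⦃a b : X⦄ ⦃α β : ℝ⦄, t₀ ≤ α → α ≤ β → β ≤ tstar → ‖a - x₀‖ ≤ α - t₀ →
      ‖b - a‖ ≤ β - α → ‖F' b - F' a‖ ≤ f' β - f' α)
    (ht0 : t 0 = t₀) (ht : ∀ n, t (n + 1) = t n - f (t n) / f' (t n))
    (hx0 : x 0 = x₀) (hx : ∀ n, x (n + 1) = x n - (F' (x n)).inverse (F (x n)))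
    {y : X} (hy : y ∈ closedBall x₀ (tstar - t₀)) (hFy : F y = 0) (n : ℕ) :
    ‖y - x n‖ ≤ tstar - t n := by
  have hmem := newtonMajorant_seq_mem_Icc hf hmono hzero hpos ht0s ht0 ht
  have hsucc := newtonMajorant_seq_le_succ hf hmono hzero hpos ht0s ht0 ht
  have hmaj := fderivMajorantNewton_majorizes hF hf hmono hzero hpos ht0s hA ha1 ha2 hN ht0 ht hx0 hx
  induction n with
  | zero =>
    rw [hx0, ht0]
    rwa [mem_closedBall, dist_eq_norm] at hy
  | succ n ih =>
    rcases (hmem n).2.eq_or_lt with heq | hlt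
    · -- stationary case `tₙ = t*`: `y = xₙ = x_{n+1}`
      have h1 : t (n + 1) = tstar := le_antisymm (hmem (n + 1)).2 (heq ▸ hsucc n)
      have hyx : y = x n := by
        have : ‖y - x n‖ ≤ 0 := by simpa [heq] using ih
        exact sub_eq_zero.1 (norm_le_zero_iff.1 this)
      have hxx : x (n + 1) = x n := by
        have : ‖x (n + 1) - x n‖ ≤ 0 := by simpa [heq, h1] using (hmaj n).1
        exact sub_eq_zero.1 (norm_le_zero_iff.1 this)
      rw [hyx, hxx, sub_self, norm_zero, h1, sub_self]
    · have hdn : f' (t n) < 0 := (newtonMajorant_deriv_neg hf hmono hzero hpos ⟨(hmem n).1, hlt⟩).2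
      obtain ⟨hinv, hΓ⟩ := fderivMajorantNewton_inverse_le hA ha1 hmono hN (hmem n) hdn (hmaj n).2
      have hrem := fderivMajorantNewton_remainder_le hF hf hN (a := x n) (b := y)
        (hmem n).1 (hmem n).2 le_rfl (hmaj n).2 ih
      have e : y - x (n + 1) = -((F' (x n)).inverse (F y - F (x n) - F' (x n) (y - x n))) := by
        have h1 := hinv.inverse_apply_self (y - x n)
        rw [hx n, hFy, zero_sub, map_sub, map_neg, h1]
        abel
      have hne : f' (t n) ≠ 0 := hdn.ne
      rw [e, norm_neg]
      calc ‖(F' (x n)).inverse (F y - F (x n) - F' (x n) (y - x n))‖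
          ≤ ‖(F' (x n)).inverse‖ * ‖F y - F (x n) - F' (x n) (y - x n)‖ :=
            ContinuousLinearMap.le_opNorm _ _
        _ ≤ -1 / f' (t n) * (f tstar - f (t n) - f' (t n) * (tstar - t n)) :=
            mul_le_mul hΓ hrem (norm_nonneg _) (div_nonneg_of_nonpos (by norm_num) hdn.le)
        _ = tstar - t (n + 1) := by
            rw [ht n, hzero]; field_simp; ring

/-- **Every solution in the closed ball attracts the Newton sequence:** `xₙ → y*`
("since `limₙ tₙ = t*`, the uniqueness of `x*` follows immediately").
[cite: EzquerrofernandezHernandezveron2017, §4.1.1 Theorem 4.5, end of proof (p. 132)] -/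
theorem fderivMajorantNewton_tendsto_of_zero [CompleteSpace X]
    (hF : ∀ z ∈ closedBall x₀ (tstar - t₀), HasFDerivAt F (F' z) z)
    (hf : ∀ s ∈ Icc t₀ tstar, HasDerivAt f (f' s) s) (hmono : MonotoneOn f' (Icc t₀ tstar))
    (hzero : f tstar = 0) (hpos : ∀ s ∈ Ico t₀ tstar, 0 < f s) (ht0s : t₀ ≤ tstar)
    (hA : (F' x₀).IsInvertible) (ha1 : ‖(F' x₀).inverse‖ ≤ -1 / f' t₀)
    (ha2 : ‖(F' x₀).inverse (F x₀)‖ ≤ -(f t₀ / f' t₀))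
    (hN : ∀ ⦃a b : X⦄ ⦃α β : ℝ⦄, t₀ ≤ α → α ≤ β → β ≤ tstar → ‖a - x₀‖ ≤ α - t₀ →
      ‖b - a‖ ≤ β - α → ‖F' b - F' a‖ ≤ f' β - f' α)
    (ht0 : t 0 = t₀) (ht : ∀ n, t (n + 1) = t n - f (t n) / f' (t n))
    (hx0 : x 0 = x₀) (hx : ∀ n, x (n + 1) = x n - (F' (x n)).inverse (F (x n)))
    {y : X} (hy : y ∈ closedBall x₀ (tstar - t₀)) (hFy : F y = 0) :
    Tendsto x atTop (𝓝 y) := by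
  have hT := newtonMajorant_seq_tendsto hf hmono hzero hpos ht0s ht0 ht
  have h0 : Tendsto (fun n => tstar - t n) atTop (𝓝 0) := by
    simpa using (tendsto_const_nhds (x := tstar)).sub hT
  have hbound := fderivMajorantNewton_zero_dist_le hF hf hmono hzero hpos ht0s hA ha1 ha2 hN ht0 ht
    hx0 hx hy hFy
  refine tendsto_iff_norm_sub_tendsto_zero.2 (squeeze_zero (fun n => norm_nonneg _) (fun n => ?_) h0)
  rw [norm_sub_rev]; exact hbound n

/-- **Theorem 4.5, closed ball: uniqueness of the solution in `B̄(x₀, t* − t₀)`** (the book's case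
`t** = t*`; the argument is valid for every `t*`).  Two zeros of `F` in the closed ball coincide.
[cite: EzquerrofernandezHernandezveron2017, §4.1.1 Theorem 4.5 (case t** = t*: "unique … in B̄(x₀, t* − t₀)") with proof (p. 132)] -/
theorem fderivMajorantNewton_zero_unique [CompleteSpace X]
    (hF : ∀ z ∈ closedBall x₀ (tstar - t₀), HasFDerivAt F (F' z) z)
    (hf : ∀ s ∈ Icc t₀ tstar, HasDerivAt f (f' s) s) (hmono : MonotoneOn f' (Icc t₀ tstar))
    (hzero : f tstar = 0) (hpos : ∀ s ∈ Ico t₀ tstar, 0 < f s) (ht0s : t₀ ≤ tstar)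
    (hA : (F' x₀).IsInvertible) (ha1 : ‖(F' x₀).inverse‖ ≤ -1 / f' t₀)
    (ha2 : ‖(F' x₀).inverse (F x₀)‖ ≤ -(f t₀ / f' t₀))
    (hN : ∀ ⦃a b : X⦄ ⦃α β : ℝ⦄, t₀ ≤ α → α ≤ β → β ≤ tstar → ‖a - x₀‖ ≤ α - t₀ →
      ‖b - a‖ ≤ β - α → ‖F' b - F' a‖ ≤ f' β - f' α)
    (ht0 : t 0 = t₀) (ht : ∀ n, t (n + 1) = t n - f (t n) / f' (t n))
    (hx0 : x 0 = x₀) (hx : ∀ n, x (n + 1) = x n - (F' (x n)).inverse (F (x n)))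
    {y₁ y₂ : X} (hy₁ : y₁ ∈ closedBall x₀ (tstar - t₀)) (hFy₁ : F y₁ = 0)
    (hy₂ : y₂ ∈ closedBall x₀ (tstar - t₀)) (hFy₂ : F y₂ = 0) : y₁ = y₂ :=
  tendsto_nhds_unique
    (fderivMajorantNewton_tendsto_of_zero hF hf hmono hzero hpos ht0s hA ha1 ha2 hN ht0 ht hx0 hx
      hy₁ hFy₁)
    (fderivMajorantNewton_tendsto_of_zero hF hf hmono hzero hpos ht0s hA ha1 ha2 hN ht0 ht hx0 hx
      hy₂ hFy₂)

/-- **Theorems 4.4 + 4.5 (closed ball): existence and uniqueness** — exactly one solution of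
`F(x) = 0` in `B̄(x₀, t* − t₀)`.
[cite: EzquerrofernandezHernandezveron2017, §4.1.1 Theorem 4.4; Theorem 4.5 (case t** = t*)] -/
theorem fderivMajorantNewton_existsUnique_zero [CompleteSpace X]
    (hF : ∀ z ∈ closedBall x₀ (tstar - t₀), HasFDerivAt F (F' z) z)
    (hf : ∀ s ∈ Icc t₀ tstar, HasDerivAt f (f' s) s) (hmono : MonotoneOn f' (Icc t₀ tstar))
    (hzero : f tstar = 0) (hpos : ∀ s ∈ Ico t₀ tstar, 0 < f s) (ht0s : t₀ ≤ tstar)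
    (hA : (F' x₀).IsInvertible) (ha1 : ‖(F' x₀).inverse‖ ≤ -1 / f' t₀)
    (ha2 : ‖(F' x₀).inverse (F x₀)‖ ≤ -(f t₀ / f' t₀))
    (hN : ∀ ⦃a b : X⦄ ⦃α β : ℝ⦄, t₀ ≤ α → α ≤ β → β ≤ tstar → ‖a - x₀‖ ≤ α - t₀ →
      ‖b - a‖ ≤ β - α → ‖F' b - F' a‖ ≤ f' β - f' α)
    (ht0 : t 0 = t₀) (ht : ∀ n, t (n + 1) = t n - f (t n) / f' (t n))
    (hx0 : x 0 = x₀) (hx : ∀ n, x (n + 1) = x n - (F' (x n)).inverse (F (x n))) :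
    ∃! y, y ∈ closedBall x₀ (tstar - t₀) ∧ F y = 0 := by
  obtain ⟨-, xstar, hmem, -, hFx, -⟩ :=
    fderivMajorantNewton_semilocal hF hf hmono hzero hpos ht0s hA ha1 ha2 hN ht0 ht hx0 hx
  exact ⟨xstar, ⟨hmem, hFx⟩, fun y hy =>
    fderivMajorantNewton_zero_unique hF hf hmono hzero hpos ht0s hA ha1 ha2 hN ht0 ht hx0 hx hy.1 hy.2
      hmem hFx⟩

end Semilocal

/-! ## Theorem 4.5: the open ball `B(x₀, t** − t₀)` -/

section OpenBall

variable {X Y : Type*} [NormedAddCommGroup X] [NormedSpace ℝ X] [NormedAddCommGroup Y]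
  [NormedSpace ℝ Y] {F : X → Y} {F' : X → X →L[ℝ] Y} {f f' : ℝ → ℝ} {x₀ : X} {t₀ tstar tss : ℝ}
  {x : ℕ → X} {t : ℕ → ℝ}

/-- Restriction of the open-ball hypotheses (`B(x₀, t** − t₀)`, levels `[t₀, t**)`) to the closed
ball `B̄(x₀, t' − t₀)` and `[t₀, t']` for `t' < t**`.
[folklore] -/
private theorem fmsAux_restrict {t' : ℝ} (ht' : t' < tss)
    (hF : ∀ z ∈ ball x₀ (tss - t₀), HasFDerivAt F (F' z) z)
    (hf : ∀ s ∈ Ico t₀ tss, HasDerivAt f (f' s) s) (hmono : MonotoneOn f' (Ico t₀ tss))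
    (hN : ∀ ⦃a b : X⦄ ⦃α β : ℝ⦄, t₀ ≤ α → α ≤ β → β < tss → ‖a - x₀‖ ≤ α - t₀ →
      ‖b - a‖ ≤ β - α → ‖F' b - F' a‖ ≤ f' β - f' α) :
    (∀ z ∈ closedBall x₀ (t' - t₀), HasFDerivAt F (F' z) z) ∧
      (∀ s ∈ Icc t₀ t', HasDerivAt f (f' s) s) ∧ MonotoneOn f' (Icc t₀ t') ∧
      (∀ ⦃a b : X⦄ ⦃α β : ℝ⦄, t₀ ≤ α → α ≤ β → β ≤ t' → ‖a - x₀‖ ≤ α - t₀ →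
        ‖b - a‖ ≤ β - α → ‖F' b - F' a‖ ≤ f' β - f' α) := by
  have hsub : closedBall x₀ (t' - t₀) ⊆ ball x₀ (tss - t₀) := closedBall_subset_ball (by linarith)
  exact ⟨fun z hz => hF z (hsub hz), fun s hs => hf s ⟨hs.1, lt_of_le_of_lt hs.2 ht'⟩,
    hmono.mono fun s hs => ⟨hs.1, lt_of_le_of_lt hs.2 ht'⟩,
    fun a b α β hα hαβ hβ ha hab => hN hα hαβ (lt_of_le_of_lt hβ ht') ha hab⟩

/-- **Theorem 4.5, open ball: every solution in `B(x₀, t** − t₀)` is the limit of the Newton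
sequence.**  Hypotheses: those of Theorem 4.4 on the open ball `B(x₀, t** − t₀)` and the levels
`[t₀, t**)`, with `t* < t**` and `f < 0` on `(t*, t**)` (e.g. `t**` the second zero of `f`).  For a
solution `y*` with `‖y* − x₀‖ ≤ t* − t₀` this is the closed-ball case; otherwise
`s₁ = t₀ + ‖y* − x₀‖ ∈ (t*, t**)` and, fencing `z ↦ z − Γ₀F(z)` along the segment from the limit `x*`
to `y*` (`‖Γ₀(F'(z) − F'(x₀))‖ ≤ ‖Γ₀‖(f'(σ) − f'(t₀))`, `σ = t* + τ(s₁ − t*)`), one gets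
`‖y* − x*‖ ≤ ‖Γ₀‖‖y* − x*‖(f(s₁)/(s₁ − t*) − f'(t₀)) < ‖y* − x*‖` unless `y* = x*` — the book's
`‖I − J‖ < 1` for `J = Γ₀∫₀¹F'(x* + τ(y* − x*))dτ`.
[cite: EzquerrofernandezHernandezveron2017, §4.1.1 Theorem 4.5 (case t* < t**) with proof ("‖I − J‖ ≤ ‖Γ₀‖∫₀¹‖F'(x* + τ(y* − x*)) − F'(x₀)‖dτ < … = 1", pp. 131–132)] -/
theorem fderivMajorantNewton_tendsto_of_zero_ball [CompleteSpace X]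
    (hF : ∀ z ∈ ball x₀ (tss - t₀), HasFDerivAt F (F' z) z)
    (hf : ∀ s ∈ Ico t₀ tss, HasDerivAt f (f' s) s) (hmono : MonotoneOn f' (Ico t₀ tss))
    (hzero : f tstar = 0) (hpos : ∀ s ∈ Ico t₀ tstar, 0 < f s) (ht0s : t₀ ≤ tstar)
    (hss : tstar < tss) (hneg : ∀ s ∈ Ioo tstar tss, f s < 0)
    (hA : (F' x₀).IsInvertible) (ha1 : ‖(F' x₀).inverse‖ ≤ -1 / f' t₀)
    (ha2 : ‖(F' x₀).inverse (F x₀)‖ ≤ -(f t₀ / f' t₀))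
    (hN : ∀ ⦃a b : X⦄ ⦃α β : ℝ⦄, t₀ ≤ α → α ≤ β → β < tss → ‖a - x₀‖ ≤ α - t₀ →
      ‖b - a‖ ≤ β - α → ‖F' b - F' a‖ ≤ f' β - f' α)
    (ht0 : t 0 = t₀) (ht : ∀ n, t (n + 1) = t n - f (t n) / f' (t n))
    (hx0 : x 0 = x₀) (hx : ∀ n, x (n + 1) = x n - (F' (x n)).inverse (F (x n)))
    {y : X} (hy : y ∈ ball x₀ (tss - t₀)) (hFy : F y = 0) :
    Tendsto x atTop (𝓝 y) := by
  obtain ⟨hF₁, hf₁, hmono₁, hN₁⟩ := fmsAux_restrict hss hF hf hmono hN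
  obtain ⟨-, xstar, hmem, hX, hFx, -⟩ :=
    fderivMajorantNewton_semilocal hF₁ hf₁ hmono₁ hzero hpos ht0s hA ha1 ha2 hN₁ ht0 ht hx0 hx
  suffices hyx : y = xstar by rwa [hyx]
  by_cases hyc : ‖y - x₀‖ ≤ tstar - t₀
  · exact fderivMajorantNewton_zero_unique hF₁ hf₁ hmono₁ hzero hpos ht0s hA ha1 ha2 hN₁ ht0 ht hx0 hx
      (mem_closedBall.2 (by rwa [dist_eq_norm])) hFy hmem hFx
  -- the case `t* − t₀ < ‖y − x₀‖ < t** − t₀`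
  have hyc' : tstar - t₀ < ‖y - x₀‖ := lt_of_not_ge hyc
  rw [mem_ball, dist_eq_norm] at hy
  rw [mem_closedBall, dist_eq_norm] at hmem
  set s₁ : ℝ := t₀ + ‖y - x₀‖ with hs₁
  have hs₁l : tstar < s₁ := by rw [hs₁]; linarith
  have hs₁u : s₁ < tss := by rw [hs₁]; linarith
  have hfs₁ : f s₁ < 0 := hneg s₁ ⟨hs₁l, hs₁u⟩
  -- `f'(t₀) < 0`: a mean value point of `[t*, s₁]` has negative derivative
  have hd0 : f' t₀ < 0 := by
    obtain ⟨ξ, hξ, hξeq⟩ := exists_hasDerivAt_eq_slope f f' hs₁l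
      (fun u hu => (hf u ⟨ht0s.trans hu.1, lt_of_le_of_lt hu.2 hs₁u⟩).continuousAt.continuousWithinAt)
      (fun u hu => hf u ⟨ht0s.trans hu.1.le, hu.2.trans hs₁u⟩)
    have hξneg : f' ξ < 0 := by
      rw [hξeq, hzero, sub_zero]; exact div_neg_of_neg_of_pos hfs₁ (sub_pos.2 hs₁l)
    exact lt_of_le_of_lt (hmono ⟨le_rfl, lt_of_le_of_lt ht0s (hs₁l.trans hs₁u)⟩
      ⟨ht0s.trans hξ.1.le, hξ.2.trans hs₁u⟩ (ht0s.trans hξ.1.le)) hξneg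
  -- the segment from `x*` to `y`, the levels `σ(τ) = t* + τ(s₁ − t*)`
  set d : X := y - xstar with hd
  set Γ₀ : Y →L[ℝ] X := (F' x₀).inverse with hΓ₀
  set γ : ℝ → X := fun τ => xstar + τ • d with hγ
  set σ : ℝ → ℝ := fun τ => tstar + τ * (s₁ - tstar) with hσ
  have hγ' : ∀ τ, HasDerivAt γ d τ := fun τ => by
    simpa [hγ] using ((hasDerivAt_id τ).smul_const d).const_add xstar
  have hσ' : ∀ τ, HasDerivAt σ (s₁ - tstar) τ := fun τ => by
    simpa [hσ] using ((hasDerivAt_id τ).mul_const (s₁ - tstar)).const_add tstar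
  have hσmem : ∀ τ ∈ Icc (0:ℝ) 1, tstar ≤ σ τ ∧ σ τ ≤ s₁ := by
    intro τ hτ
    refine ⟨?_, ?_⟩
    · have : 0 ≤ τ * (s₁ - tstar) := mul_nonneg hτ.1 (sub_nonneg.2 hs₁l.le)
      simp only [hσ]; linarith
    · have : τ * (s₁ - tstar) ≤ 1 * (s₁ - tstar) :=
        mul_le_mul_of_nonneg_right hτ.2 (sub_nonneg.2 hs₁l.le)
      simp only [hσ]; linarith
  have hγdist : ∀ τ ∈ Icc (0:ℝ) 1, ‖γ τ - x₀‖ ≤ σ τ - t₀ := by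
    intro τ hτ
    have e : γ τ - x₀ = (1 - τ) • (xstar - x₀) + τ • (y - x₀) := by
      simp only [hγ, hd, sub_smul, one_smul, smul_sub]; abel
    rw [e]
    calc ‖(1 - τ) • (xstar - x₀) + τ • (y - x₀)‖
        ≤ ‖(1 - τ) • (xstar - x₀)‖ + ‖τ • (y - x₀)‖ := norm_add_le _ _
      _ = (1 - τ) * ‖xstar - x₀‖ + τ * ‖y - x₀‖ := by
          rw [norm_smul, norm_smul, Real.norm_of_nonneg (sub_nonneg.2 hτ.2),
            Real.norm_of_nonneg hτ.1]
      _ ≤ (1 - τ) * (tstar - t₀) + τ * (s₁ - t₀) := by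
          have h1 := mul_le_mul_of_nonneg_left hmem (sub_nonneg.2 hτ.2)
          have h2 : τ * ‖y - x₀‖ = τ * (s₁ - t₀) := by rw [hs₁]; ring
          linarith
      _ = σ τ - t₀ := by simp only [hσ]; ring
  have hγmem : ∀ τ ∈ Icc (0:ℝ) 1, γ τ ∈ ball x₀ (tss - t₀) := by
    intro τ hτ
    rw [mem_ball, dist_eq_norm]
    linarith [hγdist τ hτ, (hσmem τ hτ).2]
  -- `ψ(τ) = γ(τ) − x* − Γ₀(F(γ τ) − F(x*))`, `ψ' = d − Γ₀F'(γ τ)d = −Γ₀(F'(γ τ) − F'(x₀))d`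
  have hψ' : ∀ τ ∈ Icc (0:ℝ) 1,
      HasDerivAt (fun τ => γ τ - xstar - Γ₀ (F (γ τ) - F xstar)) (d - Γ₀ (F' (γ τ) d)) τ := by
    intro τ hτ
    have h1 : HasDerivAt (fun τ => F (γ τ) - F xstar) (F' (γ τ) d) τ :=
      ((hF _ (hγmem τ hτ)).comp_hasDerivAt τ (hγ' τ)).sub_const (F xstar)
    have h2 : HasDerivAt (fun τ => Γ₀ (F (γ τ) - F xstar)) (Γ₀ (F' (γ τ) d)) τ :=
      Γ₀.hasFDerivAt.comp_hasDerivAt τ h1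
    exact ((hγ' τ).sub_const xstar).sub h2
  have hbound : ∀ τ ∈ Ico (0:ℝ) 1,
      ‖d - Γ₀ (F' (γ τ) d)‖ ≤ ‖Γ₀‖ * ‖d‖ * (f' (σ τ) * (s₁ - tstar) / (s₁ - tstar) - f' t₀) := by
    intro τ hτ
    have hτ' := Ico_subset_Icc_self hτ
    rw [mul_div_cancel_right₀ _ (sub_pos.2 hs₁l).ne']
    have hdiff : ‖F' (γ τ) - F' x₀‖ ≤ f' (σ τ) - f' t₀ :=
      hN le_rfl (ht0s.trans (hσmem τ hτ').1) (lt_of_le_of_lt (hσmem τ hτ').2 hs₁u)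
        (by rw [sub_self, norm_zero, sub_self]) (hγdist τ hτ')
    have e : d - Γ₀ (F' (γ τ) d) = -(Γ₀ ((F' (γ τ) - F' x₀) d)) := by
      have h1 : Γ₀ (F' x₀ d) = d := by rw [hΓ₀]; exact hA.inverse_apply_self d
      have h2 : Γ₀ ((F' (γ τ) - F' x₀) d) = Γ₀ (F' (γ τ) d) - Γ₀ (F' x₀ d) := by
        rw [sub_apply]; exact Γ₀.map_sub _ _
      rw [h2, h1]; abel
    rw [e, norm_neg]
    calc ‖Γ₀ ((F' (γ τ) - F' x₀) d)‖ ≤ ‖Γ₀‖ * ‖(F' (γ τ) - F' x₀) d‖ := Γ₀.le_opNorm _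
      _ ≤ ‖Γ₀‖ * (‖F' (γ τ) - F' x₀‖ * ‖d‖) :=
          mul_le_mul_of_nonneg_left ((F' (γ τ) - F' x₀).le_opNorm d) (norm_nonneg _)
      _ ≤ ‖Γ₀‖ * ((f' (σ τ) - f' t₀) * ‖d‖) :=
          mul_le_mul_of_nonneg_left (mul_le_mul_of_nonneg_right hdiff (norm_nonneg _))
            (norm_nonneg _)
      _ = ‖Γ₀‖ * ‖d‖ * (f' (σ τ) - f' t₀) := by ring
  -- the fence `B(τ) = ‖Γ₀‖‖d‖((f(σ τ) − f(t*))/(s₁ − t*) − τ f'(t₀))`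
  have hB' : ∀ τ ∈ Icc (0:ℝ) 1, HasDerivAt
      (fun τ => ‖Γ₀‖ * ‖d‖ * ((f (σ τ) - f tstar) / (s₁ - tstar) - τ * f' t₀))
      (‖Γ₀‖ * ‖d‖ * (f' (σ τ) * (s₁ - tstar) / (s₁ - tstar) - f' t₀)) τ := by
    intro τ hτ
    have hσI : σ τ ∈ Ico t₀ tss :=
      ⟨ht0s.trans (hσmem τ hτ).1, lt_of_le_of_lt (hσmem τ hτ).2 hs₁u⟩
    have h1 : HasDerivAt (fun τ => (f (σ τ) - f tstar) / (s₁ - tstar))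
        (f' (σ τ) * (s₁ - tstar) / (s₁ - tstar)) τ :=
      (((hf _ hσI).comp τ (hσ' τ)).sub_const (f tstar)).div_const (s₁ - tstar)
    have h2 : HasDerivAt (fun τ : ℝ => τ * f' t₀) (f' t₀) τ := by
      simpa using (hasDerivAt_id τ).mul_const (f' t₀)
    exact (h1.sub h2).const_mul (‖Γ₀‖ * ‖d‖)
  have key := image_norm_le_of_norm_deriv_right_le_deriv_boundary'
    (f := fun τ => γ τ - xstar - Γ₀ (F (γ τ) - F xstar)) (a := 0) (b := 1)
    (f' := fun τ => d - Γ₀ (F' (γ τ) d))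
    (fun τ hτ => (hψ' τ hτ).continuousAt.continuousWithinAt)
    (fun τ hτ => (hψ' τ (Ico_subset_Icc_self hτ)).hasDerivWithinAt)
    (B := fun τ => ‖Γ₀‖ * ‖d‖ * ((f (σ τ) - f tstar) / (s₁ - tstar) - τ * f' t₀))
    (B' := fun τ => ‖Γ₀‖ * ‖d‖ * (f' (σ τ) * (s₁ - tstar) / (s₁ - tstar) - f' t₀))
    (by simp [hγ, hσ])
    (fun τ hτ => (hB' τ hτ).continuousAt.continuousWithinAt)
    (fun τ hτ => (hB' τ (Ico_subset_Icc_self hτ)).hasDerivWithinAt)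
    hbound (right_mem_Icc.2 zero_le_one)
  -- at `τ = 1`: `‖d‖ ≤ ‖Γ₀‖‖d‖(f(s₁)/(s₁ − t*) − f'(t₀))`
  have hfin : ‖d‖ ≤ ‖Γ₀‖ * ‖d‖ * (f s₁ / (s₁ - tstar) - f' t₀) := by
    have key' : ‖γ 1 - xstar - Γ₀ (F (γ 1) - F xstar)‖ ≤
        ‖Γ₀‖ * ‖d‖ * ((f (σ 1) - f tstar) / (s₁ - tstar) - 1 * f' t₀) := key
    have hγ1 : γ 1 = y := by simp [hγ, hd]
    have e1 : γ 1 - xstar - Γ₀ (F (γ 1) - F xstar) = d := by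
      rw [hγ1, hFy, hFx, sub_zero, map_zero, sub_zero]
    have hσ1 : σ 1 = s₁ := by simp [hσ]
    have e2 : (f (σ 1) - f tstar) / (s₁ - tstar) - 1 * f' t₀ = f s₁ / (s₁ - tstar) - f' t₀ := by
      rw [hσ1, hzero, sub_zero, one_mul]
    rw [e1, e2] at key'
    exact key'
  have hq : f s₁ / (s₁ - tstar) < 0 := div_neg_of_neg_of_pos hfs₁ (sub_pos.2 hs₁l)
  have hΓ1 : ‖Γ₀‖ * (-f' t₀) ≤ 1 := by
    have hne0 : f' t₀ ≠ 0 := hd0.ne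
    have h := mul_le_mul_of_nonneg_right ha1 (neg_nonneg.2 hd0.le)
    have e : -1 / f' t₀ * (-f' t₀) = 1 := by
      rw [div_mul_eq_mul_div, neg_mul_neg, one_mul, div_self hne0]
    rwa [e] at h
  have hP : 0 ≤ ‖Γ₀‖ * ‖d‖ * (f s₁ / (s₁ - tstar)) := by
    have h1 : ‖d‖ * (‖Γ₀‖ * (-f' t₀)) ≤ ‖d‖ * 1 := mul_le_mul_of_nonneg_left hΓ1 (norm_nonneg _)
    nlinarith [hfin, h1]
  have hP' : ‖Γ₀‖ * ‖d‖ * (f s₁ / (s₁ - tstar)) ≤ 0 :=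
    mul_nonpos_of_nonneg_of_nonpos (mul_nonneg (norm_nonneg _) (norm_nonneg _)) hq.le
  have hprod : ‖Γ₀‖ * ‖d‖ = 0 := by
    have h0 : ‖Γ₀‖ * ‖d‖ * (f s₁ / (s₁ - tstar)) = 0 := le_antisymm hP' hP
    rcases mul_eq_zero.1 h0 with h | h
    · exact h
    · exact absurd h hq.ne
  have hd0' : ‖d‖ ≤ 0 := by
    have : ‖Γ₀‖ * ‖d‖ * (f s₁ / (s₁ - tstar) - f' t₀) = 0 := by rw [hprod, zero_mul]
    rw [this] at hfin; exact hfin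
  have : d = 0 := norm_le_zero_iff.1 hd0'
  rw [hd] at this
  exact sub_eq_zero.1 this

/-- **Theorem 4.5, open ball: uniqueness of the solution in `B(x₀, t** − t₀)` when `t* < t**` and
`f < 0` on `(t*, t**)`.**  Two zeros of `F` in the open ball coincide; in particular the limit
`x* ∈ B̄(x₀, t* − t₀)` of Theorem 4.4 is the only solution of `F(x) = 0` in `B(x₀, t** − t₀)`.
[cite: EzquerrofernandezHernandezveron2017, §4.1.1 Theorem 4.5 (case t* < t**: "the solution x* is unique in B(x₀, t** − t₀) ∩ Ω") with proof (pp. 131–132)] -/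
theorem fderivMajorantNewton_zero_unique_ball [CompleteSpace X]
    (hF : ∀ z ∈ ball x₀ (tss - t₀), HasFDerivAt F (F' z) z)
    (hf : ∀ s ∈ Ico t₀ tss, HasDerivAt f (f' s) s) (hmono : MonotoneOn f' (Ico t₀ tss))
    (hzero : f tstar = 0) (hpos : ∀ s ∈ Ico t₀ tstar, 0 < f s) (ht0s : t₀ ≤ tstar)
    (hss : tstar < tss) (hneg : ∀ s ∈ Ioo tstar tss, f s < 0)
    (hA : (F' x₀).IsInvertible) (ha1 : ‖(F' x₀).inverse‖ ≤ -1 / f' t₀)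
    (ha2 : ‖(F' x₀).inverse (F x₀)‖ ≤ -(f t₀ / f' t₀))
    (hN : ∀ ⦃a b : X⦄ ⦃α β : ℝ⦄, t₀ ≤ α → α ≤ β → β < tss → ‖a - x₀‖ ≤ α - t₀ →
      ‖b - a‖ ≤ β - α → ‖F' b - F' a‖ ≤ f' β - f' α)
    (ht0 : t 0 = t₀) (ht : ∀ n, t (n + 1) = t n - f (t n) / f' (t n))
    (hx0 : x 0 = x₀) (hx : ∀ n, x (n + 1) = x n - (F' (x n)).inverse (F (x n)))
    {y₁ y₂ : X} (hy₁ : y₁ ∈ ball x₀ (tss - t₀)) (hFy₁ : F y₁ = 0)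
    (hy₂ : y₂ ∈ ball x₀ (tss - t₀)) (hFy₂ : F y₂ = 0) : y₁ = y₂ :=
  tendsto_nhds_unique
    (fderivMajorantNewton_tendsto_of_zero_ball hF hf hmono hzero hpos ht0s hss hneg hA ha1 ha2 hN ht0
      ht hx0 hx hy₁ hFy₁)
    (fderivMajorantNewton_tendsto_of_zero_ball hF hf hmono hzero hpos ht0s hss hneg hA ha1 ha2 hN ht0
      ht hx0 hx hy₂ hFy₂)

/-- **Theorems 4.4 + 4.5 (open ball): existence in `B̄(x₀, t* − t₀)`, uniqueness in
`B(x₀, t** − t₀)`.**  There is exactly one solution of `F(x) = 0` in the open ball `B(x₀, t** − t₀)`,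
and it lies in `B̄(x₀, t* − t₀)`.
[cite: EzquerrofernandezHernandezveron2017, §4.1.1 Theorems 4.4 and 4.5 (case t* < t**)] -/
theorem fderivMajorantNewton_existsUnique_zero_ball [CompleteSpace X]
    (hF : ∀ z ∈ ball x₀ (tss - t₀), HasFDerivAt F (F' z) z)
    (hf : ∀ s ∈ Ico t₀ tss, HasDerivAt f (f' s) s) (hmono : MonotoneOn f' (Ico t₀ tss))
    (hzero : f tstar = 0) (hpos : ∀ s ∈ Ico t₀ tstar, 0 < f s) (ht0s : t₀ ≤ tstar)
    (hss : tstar < tss) (hneg : ∀ s ∈ Ioo tstar tss, f s < 0)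
    (hA : (F' x₀).IsInvertible) (ha1 : ‖(F' x₀).inverse‖ ≤ -1 / f' t₀)
    (ha2 : ‖(F' x₀).inverse (F x₀)‖ ≤ -(f t₀ / f' t₀))
    (hN : ∀ ⦃a b : X⦄ ⦃α β : ℝ⦄, t₀ ≤ α → α ≤ β → β < tss → ‖a - x₀‖ ≤ α - t₀ →
      ‖b - a‖ ≤ β - α → ‖F' b - F' a‖ ≤ f' β - f' α)
    (ht0 : t 0 = t₀) (ht : ∀ n, t (n + 1) = t n - f (t n) / f' (t n))
    (hx0 : x 0 = x₀) (hx : ∀ n, x (n + 1) = x n - (F' (x n)).inverse (F (x n))) :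
    ∃! y, y ∈ ball x₀ (tss - t₀) ∧ F y = 0 := by
  obtain ⟨hF₁, hf₁, hmono₁, hN₁⟩ := fmsAux_restrict hss hF hf hmono hN
  obtain ⟨-, xstar, hmem, -, hFx, -⟩ :=
    fderivMajorantNewton_semilocal hF₁ hf₁ hmono₁ hzero hpos ht0s hA ha1 ha2 hN₁ ht0 ht hx0 hx
  have hmem' : xstar ∈ ball x₀ (tss - t₀) := closedBall_subset_ball (by linarith) hmem
  exact ⟨xstar, ⟨hmem', hFx⟩, fun y hy =>
    fderivMajorantNewton_zero_unique_ball hF hf hmono hzero hpos ht0s hss hneg hA ha1 ha2 hN ht0 ht hx0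
      hx hy.1 hy.2 hmem' hFx⟩

end OpenBall

/- canary (must FAIL if uncommented: the estimate of Theorem 4.4 cannot be sharpened to a strict
inequality — for `F = f` on `ℝ` every bound is attained):
example {f f' : ℝ → ℝ} {t₀ tstar : ℝ} {t : ℕ → ℝ}
    (hf : ∀ s ∈ Icc t₀ tstar, HasDerivAt f (f' s) s) (hmono : MonotoneOn f' (Icc t₀ tstar))
    (hzero : f tstar = 0) (hpos : ∀ s ∈ Ico t₀ tstar, 0 < f s) (ht0s : t₀ ≤ tstar)
    (ht0 : t 0 = t₀) (ht : ∀ n, t (n + 1) = t n - f (t n) / f' (t n)) (n : ℕ) :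
    ‖tstar - t n‖ < tstar - t n := by
  have h := newtonMajorant_seq_mem_Icc hf hmono hzero hpos ht0s ht0 ht n
  rw [Real.norm_of_nonneg (by linarith [h.2])]
  linarith
-/

end Literature.Analysis.Calculus
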